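/-
Origin: expansion seat `planner-pub-hodgecm-pv15-g2-0`, handover #4 v2 2026-08-18T06:45:00Z (`HOME/pub-hodgecm-pv15-g2/lean/Pv15g2/KernelUnfolding.lean`, md5 c37b3f0f, 125 lines);
landed by the gen-7 packager in gate run 25 as `HodgeCM/Automorphic/KernelUnfolding.lean` (verbatim).
-/
/-
Origin: HOME/pub-hodgecm-pv15-g2/lean/Pv15g2/KernelUnfolding.lean — session planner-pub-hodgecm-pv15-g2-0
(unit pub-hodgecm-pv15-g2, DAG-NODE PROVER #15 gen 2; lineage N23a).
Intended final place (packager's call): `HodgeCM/Automorphic/KernelUnfolding.lean`.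
NEW, ADDITIVE; imports LANDED tree modules only (`HodgeCM.Automorphic.RegularRepresentation` = my run-24 file #1,
`HodgeCM.PerL34.QuotientSmoothingHaar` landed run 23).  KIND: KERNEL — nothing cited, nothing posited.
-/
import Summits.HodgeConjecture.HodgeCM.Automorphic.RegularRepresentation
import Summits.HodgeConjecture.HodgeCM.PerL34.QuotientSmoothingHaar

/-!
# Step 1 of PerL Prop 3.6 on the coset space: the unfolding identity against `L²(G ⧸ Γ)`

My gen-1 predecessor's landed `PerL34.N23a.unfolding_theta` (PseudoEisenstein.lean) is the unfolding computation of
PerL v5 ll. 413–417 for the pseudo-Eisenstein FUNCTION `E^χ_f` on `G = U(W)(𝔸)` against a LEFT fundamental domain of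
`Γ = U(W)(L₀)`.  The regular-representation model (run 24: `RegularRepresentation`, `ThetaCarrierReg`, `CocompactCarrier`)
lives on Mathlib's coset space `G ⧸ Γ` with the quotient measure `μQ = map π (μ|𝓕)` of a RIGHT (`Γ.op`) fundamental
domain `𝓕`.  This file transports the identity:

* `isFundamentalDomain_inv` — for an inversion-invariant `μ`, `𝓕⁻¹` is a LEFT fundamental domain when `𝓕` is a right one;
* `integral_quotient_eq_setIntegral_inv` — `∫_{G ⧸ Γ} F dμQ = ∫_{𝓕⁻¹} F(π(y⁻¹)) dμ(y)`;
* `unfolding_theta_quotient` — **(U) on the coset space**: for a continuous kernel `θ_x : G ⧸ Γ → ℂ` with the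
  equivariance `θ_{ω(h)x}(q) = θ_x(h⁻¹ • q)` (tex l. 414),
  `∫_{G ⧸ Γ} θ_x · E^χ_f dμQ = ∫_G f(h) (∫_T β χ (t) θ_{ω(h)x}(π (jT t)⁻¹) dν(t)) dμ(h)`.
-/

set_option autoImplicit false

noncomputable section

open MeasureTheory Set Filter Function
open scoped Pointwise

namespace HodgeCM
namespace KernelModel

open HodgeCM.PerL34.N23a HodgeCM.RegularRep

section FD

variable {G : Type*} [Group G] [MeasurableSpace G] [MeasurableInv G] {Γ : Subgroup G}

/-- **Inversion turns a right fundamental domain into a left one** (for an inversion-invariant measure). -/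
theorem isFundamentalDomain_inv (μ : Measure G) [μ.IsInvInvariant] {𝓕 : Set G}
    (h𝓕 : IsFundamentalDomain Γ.op 𝓕 μ) : IsFundamentalDomain Γ 𝓕⁻¹ μ := by
  have h := h𝓕.preimage_of_equiv (ν := μ) (f := (Inv.inv : G → G))
    (Measure.measurePreserving_inv μ).quasiMeasurePreserving
    (e := fun g : Γ.op => (Γ.equivOp.symm g)⁻¹) ((Γ.equivOp.symm.trans (Equiv.inv Γ)).bijective)
    (fun g y => by
      change ((Γ.equivOp.symm g)⁻¹ • y)⁻¹ = g • y⁻¹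
      rw [Subgroup.smul_def, Subgroup.smul_def, MulOpposite.smul_eq_mul_unop, smul_eq_mul, mul_inv_rev,
        Subgroup.coe_inv, inv_inv, Subgroup.equivOp_symm_apply_coe])
  simpa only [inv_preimage] using h

end FD

section Quotient

variable {G : Type*} [Group G] [TopologicalSpace G] [IsTopologicalGroup G] [MeasurableSpace G] [BorelSpace G]
  {Γ : Subgroup G} [MeasurableSpace (G ⧸ Γ)] [BorelSpace (G ⧸ Γ)]

/-- `∫_{G ⧸ Γ} F dμQ = ∫_{𝓕⁻¹} F(π(y⁻¹)) dμ(y)` for `μQ = map π (μ|𝓕)`, `μ` inversion invariant, `F` continuous. -/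
theorem integral_quotient_eq_setIntegral_inv (μ : Measure G) [μ.IsInvInvariant] (𝓕 : Set G)
    {μQ : Measure (G ⧸ Γ)} (hμQ : μQ = Measure.map (QuotientGroup.mk : G → G ⧸ Γ) (μ.restrict 𝓕))
    (F : G ⧸ Γ → ℂ) (hF : Continuous F) :
    ∫ q, F q ∂μQ = ∫ y in 𝓕⁻¹, F (QuotientGroup.mk y⁻¹) ∂μ := by
  subst hμQ
  rw [integral_map (QuotientGroup.continuous_mk.measurable.aemeasurable) hF.aestronglyMeasurable]
  have h := (Measure.measurePreserving_inv μ).setIntegral_preimage_emb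
    (MeasurableEquiv.inv G).measurableEmbedding (fun y => F (QuotientGroup.mk y)) 𝓕
  rw [inv_preimage] at h
  rw [← h]

end Quotient

section Unfolding

variable {G : Type*} [Group G] [TopologicalSpace G] [IsTopologicalGroup G] [T2Space G] [LocallyCompactSpace G]
  [MeasurableSpace G] [BorelSpace G]
  {Γ : Subgroup G} [Countable Γ] [MeasurableSpace (G ⧸ Γ)] [BorelSpace (G ⧸ Γ)]
  {T : Type*} [Group T] [TopologicalSpace T] [T2Space T] [MeasurableSpace T] [OpensMeasurableSpace T]

/-- **(U) on the coset space** (PerL v5 Prop 3.6 Step 1, tex ll. 413–417): for a right fundamental domain `𝓕` of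
`Γ` in `G` with `μQ = map π (μ|𝓕)` (`μ` a left- and right-invariant Haar measure), a continuous kernel family
`θ : X → (G ⧸ Γ → ℂ)` with the Weil-action equivariance `θ (ω h x) q = θ x (h⁻¹ • q)` (l. 414), and `f ∈ C_c(G)`:
`∫_{G ⧸ Γ} θ_x(q) E^χ_f(q) dμQ(q) = ∫_G f(h) (∫_T β(t)χ(t) θ_{ω(h)x}(π (jT t)⁻¹) dν(t)) dμ(h)`.
Proof: transport to the left fundamental domain `𝓕⁻¹` and apply the landed `N23a.unfolding_theta`. -/
theorem unfolding_theta_quotient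
    (μ : Measure G) [μ.IsHaarMeasure] [μ.Regular] [μ.IsMulRightInvariant]
    (ν : Measure T) [IsFiniteMeasureOnCompacts ν]
    (jT : T →* G) (hjT : Continuous jT)
    (β : T → ℝ) (hβ : Continuous β) (hβs : HasCompactSupport β)
    (χ : T → ℂ) (hχ : Continuous χ) (hΓ : DiscreteMeets Γ)
    (𝓕 : Set G) (h𝓕 : IsFundamentalDomain Γ.op 𝓕 μ)
    {μQ : Measure (G ⧸ Γ)} (hμQ : μQ = Measure.map (QuotientGroup.mk : G → G ⧸ Γ) (μ.restrict 𝓕))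
    (f : G → ℂ) (hf : Continuous f) (hfs : HasCompactSupport f)
    {X : Type*} (θ : X → G ⧸ Γ → ℂ) (ω : G → X → X) (x : X)
    (hθ : Continuous (θ x)) (hθω : ∀ (h : G) (q : G ⧸ Γ), θ (ω h x) q = θ x (h⁻¹ • q)) :
    ∫ q, θ x q * EisQ Γ ν jT β χ f q ∂μQ
      = ∫ h, f h * (∫ t, wt β χ t * θ (ω h x) (QuotientGroup.mk (jT t)⁻¹) ∂ν) ∂μ := by
  haveI : μ.IsInvInvariant := PerL34.QuotientSmoothing.isInvInvariant_of_isMulRightInvariant μ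
  -- (1) to the left fundamental domain `𝓕⁻¹`
  have hE : Continuous (EisQ Γ ν jT β χ f) := continuous_EisQ ν jT hjT β hβ hβs χ hχ hΓ f hf hfs
  rw [integral_quotient_eq_setIntegral_inv μ 𝓕 hμQ (fun q => θ x q * EisQ Γ ν jT β χ f q) (hθ.mul hE)]
  simp only [EisQ_mk, inv_inv]
  -- (2) the landed unfolding on `G`
  have h𝓕' : IsFundamentalDomain Γ 𝓕⁻¹ μ := isFundamentalDomain_inv μ h𝓕
  have hθ' : Continuous fun y : G => θ x (QuotientGroup.mk y⁻¹) :=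
    hθ.comp (QuotientGroup.continuous_mk.comp continuous_inv)
  have hθ'inv : ∀ (γ : Γ) (y : G), θ x (QuotientGroup.mk ((γ : G) * y)⁻¹) = θ x (QuotientGroup.mk y⁻¹) := by
    intro γ y
    rw [mul_inv_rev, QuotientGroup.mk_mul_of_mem _ (Γ.inv_mem γ.2)]
  have hθ'ω : ∀ (h : G) (t : T),
      θ x (QuotientGroup.mk (jT t * h)⁻¹) = θ (ω h x) (QuotientGroup.mk (jT t)⁻¹) := by
    intro h t
    rw [hθω, mul_inv_rev, MulAction.Quotient.smul_mk, smul_eq_mul]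
  exact unfolding_theta μ ν jT hjT β hβ hβs χ hχ Γ 𝓕⁻¹ h𝓕' f hf hfs
    (fun x' y => θ x' (QuotientGroup.mk y⁻¹)) ω x hθ' hθ'inv hθ'ω

end Unfolding

end KernelModel
end HodgeCM

end
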